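import Summits.Ventures.PercRepro.RankLevelSetMinorPairInduction
import Summits.Ventures.PercRepro.RankLevelSetBiIndepSum

/-! # RankLevelSetMinorPairSum — THE MIXED PROFILE OF A DIRECT SUM WITH A SPLIT SIGNATURE IS THE CONVOLUTION OF THE
FACTORS' PROFILES (night-1 g29; dossier §41.12)

For disjoint matroids `M, N` and a signature split across the summands — `Y₁ = A₁ ∪ A₂`, `Y₂ = B₁ ∪ B₂` with
`A₁, B₁ ⊆ E_M`, `A₂, B₂ ⊆ E_N` — the mixed profile of the pair of complementary minors of `M ⊕ N` is the
convolution `p_i(Y₁,Y₂) = Σ_{a ≤ i} p_a^M(A₁,B₁) · p_{i−a}^N(A₂,B₂)` (**`minorPairCount_disjointSum`**). Two steps: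
the two-sided version of g24's fiberwise product bijection (**`ncard_biIndep_disjointSum_filter_both`**: the
bi-independent `r`-sets of `M ⊕ N` whose `M`-trace satisfies `P` and whose `N`-trace satisfies `Q` number
`Σ_a #{S₁ ∈ D_a(M) : P S₁} · #{S₂ ∈ D_{r−a}(N) : Q S₂}`), and the identification of the pair profile as a filtered
bi-independent count (**`minorPairCount_eq_ncard_biIndep_filter`**: `p_i(Y₁,Y₂) = #{Z ∈ D_{i+#Y₁} : Y₁ ⊆ Z, Z ∩ Y₂ = ∅}`,
by `S ↦ S ∪ Y₁`). This is the exact tool behind the refutation of (M₀)/(Diag) on direct sums (dossier §41.12): the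
profile of a sum with a split signature is computed from the factors. Every declaration has a docstring; imports:
the cell's own modules and Mathlib only. Axioms: standard. -/

namespace PercRepro

open Set Matroid

variable {α : Type}

/-! ## The two-sided fiberwise product -/

variable {M N : Matroid α} [M.Finite] [N.Finite] {h : Disjoint M.E N.E}

/-- **The bi-independent `r`-sets of `M ⊕ N` whose `M`-trace satisfies `P` and whose `N`-trace satisfies `Q`**,
counted by the size of the `M`-trace: `Σ_{a ≤ r} #{S₁ ∈ D_a(M) : P S₁} · #{S₂ ∈ D_{r−a}(N) : Q S₂}`. -/
theorem ncard_biIndep_disjointSum_filter_both (P Q : Set α → Prop) (r : ℕ) :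
    {S ∈ biIndep (M.disjointSum N h) r | P (S ∩ M.E) ∧ Q (S ∩ N.E)}.ncard =
      ∑ a ∈ Finset.range (r + 1),
        {S₁ ∈ biIndep M a | P S₁}.ncard * {S₂ ∈ biIndep N (r - a) | Q S₂}.ncard := by
  classical
  haveI : (M.disjointSum N h).Finite :=
    ⟨by rw [Matroid.disjointSum_ground_eq]; exact M.ground_finite.union N.ground_finite⟩
  set 𝒮 : Set (Set α) := {S ∈ biIndep (M.disjointSum N h) r | P (S ∩ M.E) ∧ Q (S ∩ N.E)} with h𝒮
  have h𝒮fin : 𝒮.Finite := (biIndep_finite _ r).subset (fun S hS => hS.1)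
  have hmaps : ∀ S ∈ h𝒮fin.toFinset, (S ∩ M.E).ncard ∈ Finset.range (r + 1) := by
    intro S hS
    rw [h𝒮fin.mem_toFinset] at hS
    obtain ⟨hSE, hr, -, -⟩ := mem_biIndep_disjointSum_iff.mp hS.1
    rw [Finset.mem_range, Nat.lt_succ_iff, ← hr]
    exact Set.ncard_le_ncard Set.inter_subset_left ((M.ground_finite.union N.ground_finite).subset hSE)
  rw [Set.ncard_eq_toFinset_card 𝒮 h𝒮fin, Finset.card_eq_sum_card_fiberwise hmaps]
  refine Finset.sum_congr rfl (fun a ha => ?_)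
  rw [Finset.mem_range, Nat.lt_succ_iff] at ha
  rw [← Set.ncard_coe_finset, ← Set.ncard_prod]
  refine Set.ncard_congr (fun S _ => (S ∩ M.E, S ∩ N.E)) ?_ ?_ ?_
  · intro S hS
    obtain ⟨hS1, hSa⟩ := Finset.mem_filter.mp (Finset.mem_coe.mp hS)
    obtain ⟨hSbi, hP, hQ⟩ := h𝒮fin.mem_toFinset.mp hS1
    obtain ⟨hSE, hr, hM, hN⟩ := mem_biIndep_disjointSum_iff.mp hSbi
    have hsplit := ncard_eq_ncard_inter_add_ncard_inter h hSE
      ((M.ground_finite.union N.ground_finite).subset hSE)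
    refine Set.mem_prod.mpr ⟨⟨?_, hP⟩, ⟨?_, hQ⟩⟩
    · rw [← hSa]; exact hM
    · have : (S ∩ N.E).ncard = r - a := by omega
      rw [← this]; exact hN
  · intro S S' hS hS' hSS'
    simp only [Prod.mk.injEq] at hSS'
    obtain ⟨hS1, -⟩ := Finset.mem_filter.mp (Finset.mem_coe.mp hS)
    obtain ⟨hS'1, -⟩ := Finset.mem_filter.mp (Finset.mem_coe.mp hS')
    obtain ⟨hSE, -, -, -⟩ := mem_biIndep_disjointSum_iff.mp (h𝒮fin.mem_toFinset.mp hS1).1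
    obtain ⟨hS'E, -, -, -⟩ := mem_biIndep_disjointSum_iff.mp (h𝒮fin.mem_toFinset.mp hS'1).1
    ext x
    constructor
    · intro hx
      rcases hSE hx with hxM | hxN
      · have hx' : x ∈ S' ∩ M.E := hSS'.1 ▸ ⟨hx, hxM⟩
        exact hx'.1
      · have hx' : x ∈ S' ∩ N.E := hSS'.2 ▸ ⟨hx, hxN⟩
        exact hx'.1
    · intro hx
      rcases hS'E hx with hxM | hxN
      · have hx' : x ∈ S ∩ M.E := hSS'.1.symm ▸ ⟨hx, hxM⟩
        exact hx'.1
      · have hx' : x ∈ S ∩ N.E := hSS'.2.symm ▸ ⟨hx, hxN⟩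
        exact hx'.1
  · rintro ⟨S₁, S₂⟩ hpair
    rw [Set.mem_prod] at hpair
    obtain ⟨⟨hS₁bi, hP⟩, ⟨hS₂bi, hQ⟩⟩ := hpair
    obtain ⟨hS₁E, hS₁card, hS₁ind, hS₁cind⟩ := hS₁bi
    obtain ⟨hS₂E, hS₂card, hS₂ind, hS₂cind⟩ := hS₂bi
    have hdisj : Disjoint S₁ S₂ := Set.disjoint_of_subset hS₁E hS₂E h
    have e₁ : (S₁ ∪ S₂) ∩ M.E = S₁ := by
      rw [Set.union_inter_distrib_right, Set.inter_eq_self_of_subset_left hS₁E,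
        (Set.disjoint_of_subset_left hS₂E h.symm).inter_eq, Set.union_empty]
    have e₂ : (S₁ ∪ S₂) ∩ N.E = S₂ := by
      rw [Set.union_inter_distrib_right, Set.inter_eq_self_of_subset_left hS₂E,
        (Set.disjoint_of_subset_left hS₁E h).inter_eq, Set.empty_union]
    refine ⟨S₁ ∪ S₂, ?_, ?_⟩
    · rw [Finset.mem_coe, Finset.mem_filter, h𝒮fin.mem_toFinset]
      refine ⟨⟨?_, by rw [e₁]; exact hP, by rw [e₂]; exact hQ⟩, by rw [e₁]; exact hS₁card⟩
      rw [mem_biIndep_disjointSum_iff]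
      refine ⟨Set.union_subset_union hS₁E hS₂E, ?_, ?_, ?_⟩
      · rw [Set.ncard_union_eq hdisj (M.ground_finite.subset hS₁E) (N.ground_finite.subset hS₂E), hS₁card, hS₂card]
        omega
      · rw [e₁]; exact ⟨hS₁E, rfl, hS₁ind, hS₁cind⟩
      · rw [e₂]; exact ⟨hS₂E, rfl, hS₂ind, hS₂cind⟩
    · simp only [e₁, e₂]

/-! ## The pair profile as a filtered bi-independent count -/

variable (M)

/-- **The pair profile is a filtered bi-independent count**: for disjoint `Y₁, Y₂ ⊆ E`,
`p_i(Y₁,Y₂) = #{Z ∈ D_{i+#Y₁} : Y₁ ⊆ Z ∧ Z ∩ Y₂ = ∅}` (`S ↦ S ∪ Y₁`). -/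
theorem minorPairCount_eq_ncard_biIndep_filter {Y₁ Y₂ : Set α} (hY₁ : Y₁ ⊆ M.E) (hY₂ : Y₂ ⊆ M.E)
    (hdisj : Disjoint Y₁ Y₂) (i : ℕ) :
    minorPairCount M Y₁ Y₂ i = {Z ∈ biIndep M (i + Y₁.ncard) | Y₁ ⊆ Z ∧ Disjoint Z Y₂}.ncard := by
  have hY₁fin : Y₁.Finite := M.ground_finite.subset hY₁
  unfold minorPairCount minorPairSets biIndep
  refine Set.ncard_congr (fun S _ => S ∪ Y₁) ?_ ?_ ?_
  · rintro S ⟨hSE, hScard, hind, hind'⟩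
    have hSfin : S.Finite := M.ground_finite.subset (hSE.trans Set.sdiff_subset)
    have hdisjS : Disjoint S Y₁ := by
      rw [Set.disjoint_left]; intro x hxS hxY; exact (hSE hxS).2 (Or.inl hxY)
    refine ⟨⟨Set.union_subset (hSE.trans Set.sdiff_subset) hY₁, ?_, hind, ?_⟩, Set.subset_union_right, ?_⟩
    · rw [Set.ncard_union_eq hdisjS hSfin hY₁fin, hScard]
    · have e : M.E \ (S ∪ Y₁) = (M.E \ (Y₁ ∪ Y₂)) \ S ∪ Y₂ := by
        ext x
        simp only [Set.mem_sdiff, Set.mem_union, not_or]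
        constructor
        · rintro ⟨hxE, hxS, hx1⟩
          by_cases hx2 : x ∈ Y₂
          · exact Or.inr hx2
          · exact Or.inl ⟨⟨hxE, hx1, hx2⟩, hxS⟩
        · rintro (⟨⟨hxE, hx1, -⟩, hxS⟩ | hx2)
          · exact ⟨hxE, hxS, hx1⟩
          · exact ⟨hY₂ hx2, fun hxS => (hSE hxS).2 (Or.inr hx2), fun hx1 => Set.disjoint_left.mp hdisj hx1 hx2⟩
      rw [e]; exact hind'
    · rw [Set.disjoint_left]
      rintro x (hxS | hx1) hx2
      · exact (hSE hxS).2 (Or.inr hx2)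
      · exact Set.disjoint_left.mp hdisj hx1 hx2
  · rintro S S' ⟨hSE, -, -, -⟩ ⟨hS'E, -, -, -⟩ hSS'
    have hdisjS : Disjoint S Y₁ := by
      rw [Set.disjoint_left]; intro x hxS hxY; exact (hSE hxS).2 (Or.inl hxY)
    have hdisjS' : Disjoint S' Y₁ := by
      rw [Set.disjoint_left]; intro x hxS hxY; exact (hS'E hxS).2 (Or.inl hxY)
    rw [← Set.union_sdiff_cancel_right (fun x hx => (Set.disjoint_left.mp hdisjS hx.1 hx.2).elim),
      ← Set.union_sdiff_cancel_right (fun x hx => (Set.disjoint_left.mp hdisjS' hx.1 hx.2).elim), hSS']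
  · rintro Z ⟨⟨hZE, hZcard, hZind, hZind'⟩, hY₁Z, hZY₂⟩
    have hZfin : Z.Finite := M.ground_finite.subset hZE
    refine ⟨Z \ Y₁, ⟨?_, ?_, ?_, ?_⟩, Set.sdiff_union_of_subset hY₁Z⟩
    · intro x hx
      exact ⟨hZE hx.1, fun h => h.elim hx.2 (fun h2 => Set.disjoint_left.mp hZY₂ hx.1 h2)⟩
    · rw [Set.ncard_sdiff' hY₁Z hZfin, hZcard]; omega
    · rw [Set.sdiff_union_of_subset hY₁Z]; exact hZind
    · have e : (M.E \ (Y₁ ∪ Y₂)) \ (Z \ Y₁) ∪ Y₂ = M.E \ Z := by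
        ext x
        simp only [Set.mem_sdiff, Set.mem_union, not_or, not_and, not_not]
        constructor
        · rintro (⟨⟨hxE, hx1, -⟩, hx⟩ | hx2)
          · exact ⟨hxE, fun hxZ => hx1 (hx hxZ)⟩
          · exact ⟨hY₂ hx2, fun hxZ => Set.disjoint_left.mp hZY₂ hxZ hx2⟩
        · rintro ⟨hxE, hxZ⟩
          by_cases hx2 : x ∈ Y₂
          · exact Or.inr hx2
          · exact Or.inl ⟨⟨hxE, fun hx1 => hxZ (hY₁Z hx1), hx2⟩, fun hxZ' => absurd hxZ' hxZ⟩
      rw [e]; exact hZind'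

/-! ## The convolution for a split signature -/

variable {M}

/-- A filtered bi-independent count at a level below `#A` vanishes. -/
lemma ncard_biIndep_filter_subset_eq_zero_of_lt {A B : Set α} {a : ℕ} (hlt : a < A.ncard) :
    {S ∈ biIndep M a | A ⊆ S ∧ Disjoint S B}.ncard = 0 := by
  rw [Set.ncard_eq_zero ((biIndep_finite M a).subset (fun _ hS => hS.1))]
  ext S
  simp only [Set.mem_setOf_eq, Set.mem_empty_iff_false, iff_false, not_and]
  rintro ⟨hSE, hScard, -, -⟩ hAS -
  have := Set.ncard_le_ncard hAS (M.ground_finite.subset hSE)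
  omega

/-- A filtered bi-independent count at level `a ≥ #A` is the pair profile at `a − #A`. -/
lemma ncard_biIndep_filter_subset_eq {A B : Set α} (hA : A ⊆ M.E) (hB : B ⊆ M.E) (hdisj : Disjoint A B) {a : ℕ}
    (hle : A.ncard ≤ a) :
    {S ∈ biIndep M a | A ⊆ S ∧ Disjoint S B}.ncard = minorPairCount M A B (a - A.ncard) := by
  rw [minorPairCount_eq_ncard_biIndep_filter M hA hB hdisj, Nat.sub_add_cancel hle]

/-- **THE MIXED PROFILE OF A DIRECT SUM WITH A SPLIT SIGNATURE IS THE CONVOLUTION** of the factors' profiles: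
for `A₁, B₁ ⊆ E_M`, `A₂, B₂ ⊆ E_N` (each pair disjoint),
`p_i^{M ⊕ N}(A₁ ∪ A₂, B₁ ∪ B₂) = Σ_{a ≤ i} p_a^M(A₁,B₁) · p_{i−a}^N(A₂,B₂)`. -/
theorem minorPairCount_disjointSum {A₁ B₁ A₂ B₂ : Set α} (hA₁ : A₁ ⊆ M.E) (hB₁ : B₁ ⊆ M.E) (hA₂ : A₂ ⊆ N.E)
    (hB₂ : B₂ ⊆ N.E) (hd₁ : Disjoint A₁ B₁) (hd₂ : Disjoint A₂ B₂) (i : ℕ) :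
    minorPairCount (M.disjointSum N h) (A₁ ∪ A₂) (B₁ ∪ B₂) i =
      ∑ a ∈ Finset.range (i + 1), minorPairCount M A₁ B₁ a * minorPairCount N A₂ B₂ (i - a) := by
  classical
  haveI : (M.disjointSum N h).Finite :=
    ⟨by rw [Matroid.disjointSum_ground_eq]; exact M.ground_finite.union N.ground_finite⟩
  have hA₁fin : A₁.Finite := M.ground_finite.subset hA₁
  have hA₂fin : A₂.Finite := N.ground_finite.subset hA₂
  have hAd : Disjoint A₁ A₂ := Set.disjoint_of_subset hA₁ hA₂ h
  have hcard : (A₁ ∪ A₂).ncard = A₁.ncard + A₂.ncard := Set.ncard_union_eq hAd hA₁fin hA₂fin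
  have hsubA : A₁ ∪ A₂ ⊆ (M.disjointSum N h).E := by
    rw [Matroid.disjointSum_ground_eq]; exact Set.union_subset_union hA₁ hA₂
  have hsubB : B₁ ∪ B₂ ⊆ (M.disjointSum N h).E := by
    rw [Matroid.disjointSum_ground_eq]; exact Set.union_subset_union hB₁ hB₂
  have hdisjAB : Disjoint (A₁ ∪ A₂) (B₁ ∪ B₂) := by
    rw [Set.disjoint_left]
    rintro x (hx | hx) (hx' | hx')
    · exact Set.disjoint_left.mp hd₁ hx hx'
    · exact Set.disjoint_left.mp h (hA₁ hx) (hB₂ hx')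
    · exact Set.disjoint_left.mp h (hB₁ hx') (hA₂ hx)
    · exact Set.disjoint_left.mp hd₂ hx hx'
  rw [minorPairCount_eq_ncard_biIndep_filter _ hsubA hsubB hdisjAB, hcard]
  -- the predicate splits into the two traces
  have e : {Z ∈ biIndep (M.disjointSum N h) (i + (A₁.ncard + A₂.ncard)) | A₁ ∪ A₂ ⊆ Z ∧ Disjoint Z (B₁ ∪ B₂)} =
      {Z ∈ biIndep (M.disjointSum N h) (i + (A₁.ncard + A₂.ncard)) |
        (A₁ ⊆ Z ∩ M.E ∧ Disjoint (Z ∩ M.E) B₁) ∧ (A₂ ⊆ Z ∩ N.E ∧ Disjoint (Z ∩ N.E) B₂)} := by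
    ext Z
    simp only [Set.mem_setOf_eq]
    constructor
    · rintro ⟨hZ, hAZ, hZB⟩
      refine ⟨hZ, ⟨?_, ?_⟩, ⟨?_, ?_⟩⟩
      · exact fun x hx => ⟨hAZ (Or.inl hx), hA₁ hx⟩
      · exact Set.disjoint_of_subset_left Set.inter_subset_left (Set.disjoint_of_subset_right Set.subset_union_left hZB)
      · exact fun x hx => ⟨hAZ (Or.inr hx), hA₂ hx⟩
      · exact Set.disjoint_of_subset_left Set.inter_subset_left (Set.disjoint_of_subset_right Set.subset_union_right hZB)
    · rintro ⟨hZ, ⟨hA₁Z, hZB₁⟩, ⟨hA₂Z, hZB₂⟩⟩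
      refine ⟨hZ, ?_, ?_⟩
      · rintro x (hx | hx)
        · exact (hA₁Z hx).1
        · exact (hA₂Z hx).1
      · rw [Set.disjoint_left]
        rintro x hxZ (hx | hx)
        · exact Set.disjoint_left.mp hZB₁ ⟨hxZ, hB₁ hx⟩ hx
        · exact Set.disjoint_left.mp hZB₂ ⟨hxZ, hB₂ hx⟩ hx
  rw [e, ncard_biIndep_disjointSum_filter_both (h := h) (fun S₁ => A₁ ⊆ S₁ ∧ Disjoint S₁ B₁)
    (fun S₂ => A₂ ⊆ S₂ ∧ Disjoint S₂ B₂)]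
  -- the terms outside `[#A₁, i + #A₁]` vanish; reindex
  set c₁ := A₁.ncard with hc₁
  set c₂ := A₂.ncard with hc₂
  set F : ℕ → ℕ := fun a => {S₁ ∈ biIndep M a | A₁ ⊆ S₁ ∧ Disjoint S₁ B₁}.ncard *
    {S₂ ∈ biIndep N (i + (c₁ + c₂) - a) | A₂ ⊆ S₂ ∧ Disjoint S₂ B₂}.ncard with hF
  have hF0 : ∀ a, a < c₁ → F a = 0 := by
    intro a ha
    simp only [hF]
    rw [ncard_biIndep_filter_subset_eq_zero_of_lt ha, zero_mul]
  have hF1 : ∀ a, i + c₁ < a → a ≤ i + (c₁ + c₂) → F a = 0 := by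
    intro a ha ha'
    simp only [hF]
    rw [ncard_biIndep_filter_subset_eq_zero_of_lt (A := A₂) (B := B₂) (by omega), mul_zero]
  have hF2 : ∀ a, c₁ ≤ a → a ≤ i + c₁ →
      F a = minorPairCount M A₁ B₁ (a - c₁) * minorPairCount N A₂ B₂ (i - (a - c₁)) := by
    intro a ha1 ha2
    simp only [hF]
    rw [ncard_biIndep_filter_subset_eq hA₁ hB₁ hd₁ ha1,
      ncard_biIndep_filter_subset_eq hA₂ hB₂ hd₂ (by omega), show i + (c₁ + c₂) - a - c₂ = i - (a - c₁) by omega]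
  change ∑ a ∈ Finset.range (i + (c₁ + c₂) + 1), F a = _
  rw [Finset.range_eq_Ico, ← Finset.sum_Ico_consecutive F (Nat.zero_le c₁) (by omega : c₁ ≤ i + (c₁ + c₂) + 1),
    ← Finset.sum_Ico_consecutive F (by omega : c₁ ≤ c₁ + (i + 1)) (by omega : c₁ + (i + 1) ≤ i + (c₁ + c₂) + 1)]
  have hz1 : ∑ a ∈ Finset.Ico 0 c₁, F a = 0 :=
    Finset.sum_eq_zero (fun a ha => hF0 a (Finset.mem_Ico.mp ha).2)
  have hz2 : ∑ a ∈ Finset.Ico (c₁ + (i + 1)) (i + (c₁ + c₂) + 1), F a = 0 :=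
    Finset.sum_eq_zero (fun a ha => hF1 a (by have := (Finset.mem_Ico.mp ha).1; omega)
      (by have := (Finset.mem_Ico.mp ha).2; omega))
  rw [hz1, hz2, zero_add, add_zero, Finset.sum_Ico_eq_sum_range, show c₁ + (i + 1) - c₁ = i + 1 by omega]
  refine Finset.sum_congr rfl (fun a ha => ?_)
  rw [Finset.mem_range] at ha
  rw [hF2 (c₁ + a) (by omega) (by omega), show c₁ + a - c₁ = a by omega]

end PercRepro
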